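import Mathlib.NumberTheory.LegendreSymbol.ZModChar
import Mathlib.NumberTheory.Padics.PadicVal.Basic
import Mathlib.Data.Nat.Squarefree
import HarnessLib

/-!
# The parity of the Ferrero–Kida sum: `Σ_{p ∣ d, p odd} 2^{ord₂(p²−1)−3}` is EVEN iff `d ≡ ±1 (mod 8)` (`d` odd squarefree)

Topic `NumberTheory/IwasawaTheory` (namespace = path).  THEOREM-ONLY file (no definition, no named fact, no `sorry`), written by the prover seat `bsd-line-att-p3` g29
(cell `bsd-f1-sign2`, route `AlignedTransportAtTwo`, crux C2 stmt-BirchSwinnertonDyer-22298; closes nothing).  Elementary companion of the named fact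
`ferreroKida_classicalLambda_two_imaginaryQuadratic` (`FerreroKidaLambdaTwoImaginaryQuadratic.lean`: `λ₂(ℚ(√−d)) = −1 + Σ_{p ∣ d, p ≠ 2} 2^{ord₂(p²−1)−3}`,
Schettler 2014 Thm. 2 = Ferrero 1980 / Kida 1979), which turns «`λ₂(ℚ(√−d))` is odd» into the congruence `d ≡ ±1 (mod 8)`:

* `two_pow_padicValNat_sq_sub_one_mod_two` — `2^{ord₂(p²−1)−3}` is odd iff `p ≡ ±3 (mod 8)` (Schettler's remark after Thm. 2: «if `p ≡ ±3 (mod 8)`, then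
  `ord₂(p² − 1) = 3`»; conversely `16 ∣ p² − 1` for `p ≡ ±1 (mod 8)`);
* `ferreroKidaSum_mod_two` — the sum has the parity of `#{p ∣ d odd : p ≡ ±3 (mod 8)}`;
* ★ `even_card_filter_iff_mod_eight` — for odd squarefree `d` that count is EVEN iff `d ≡ ±1 (mod 8)`: the quadratic character `χ₈ = (2/·)` (Mathlib `ZMod.χ₈`,
  `+1` on `±1`, `−1` on `±3 (mod 8)`) is multiplicative and `d = ∏_{p ∣ d} p`;
* ★ `ferreroKidaSum_mod_two_eq_zero_iff` — **the Ferrero–Kida sum is even iff `d ≡ ±1 (mod 8)`**.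

References: [Schettler2014] Thm. 2 and the remark after it; [Washington1997] Thm. 10.8 (the order `f` of `2` modulo an odd prime: `f = 2` iff `p ≡ ±3 (mod 8)`).
-/

noncomputable section

open Finset

namespace Literature.NumberTheory.IwasawaTheory

/-! ## §1 Arithmetic of the Ferrero–Kida sum modulo `2` -/

/-- For an odd number `p`: `8 ∣ p² − 1`, and `16 ∣ p² − 1` iff `p ≡ ±1 (mod 8)`. [folklore] -/
private theorem dvd_sq_sub_one_of_odd {p : ℕ} (hp : Odd p) :
    8 ∣ p ^ 2 - 1 ∧ (16 ∣ p ^ 2 - 1 ↔ p % 8 = 1 ∨ p % 8 = 7) := by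
  have h1 : 1 ≤ p ^ 2 := Nat.one_le_pow _ _ hp.pos
  have h8 : (8 ∣ p ^ 2 - 1) ↔ 1 % 8 = p ^ 2 % 8 := (Nat.modEq_iff_dvd' h1).symm
  have h16 : (16 ∣ p ^ 2 - 1) ↔ 1 % 16 = p ^ 2 % 16 := (Nat.modEq_iff_dvd' h1).symm
  rw [h8, h16, Nat.pow_mod (n := 16), Nat.pow_mod (n := 8)]
  have hr16 : p % 16 < 16 := Nat.mod_lt _ (by norm_num)
  have hodd : p % 2 = 1 := Nat.odd_iff.mp hp
  have hm8 : p % 8 = p % 16 % 8 := (Nat.mod_mod_of_dvd p (by norm_num : 8 ∣ 16)).symm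
  have hm8' : p % 8 = p % 16 % 8 := hm8
  have hm2 : p % 16 % 2 = 1 := by rw [Nat.mod_mod_of_dvd p (by norm_num : 2 ∣ 16)]; exact hodd
  have hp8 : p % 8 % 8 = p % 8 := Nat.mod_mod _ _
  rw [show p % 8 = p % 16 % 8 from hm8'] at *
  interval_cases h : p % 16 <;> simp_all

/-- **`2^{ord₂(p²−1)−3}` is ODD iff `p ≡ ±3 (mod 8)`** (`p` an odd prime): the exponent vanishes iff `16 ∤ p² − 1`.
[cite: Schettler2014, Thm. 2 (the remark after it: `p ≡ ±3 (mod 8)` ⟹ `ord₂(p²−1) = 3`)] -/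
theorem two_pow_padicValNat_sq_sub_one_mod_two {p : ℕ} (hpr : p.Prime) (hp2 : p ≠ 2) :
    2 ^ (padicValNat 2 (p ^ 2 - 1) - 3) % 2 = if p % 8 = 3 ∨ p % 8 = 5 then 1 else 0 := by
  haveI : Fact (Nat.Prime 2) := ⟨Nat.prime_two⟩
  have hp : Odd p := hpr.odd_of_ne_two hp2
  obtain ⟨h8, h16⟩ := dvd_sq_sub_one_of_odd hp
  have hodd : p % 2 = 1 := Nat.odd_iff.mp hp
  have hne : p ^ 2 - 1 ≠ 0 := by
    have h3 : 3 ≤ p := by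
      have := hpr.two_le
      omega
    have : 9 ≤ p ^ 2 := by nlinarith
    omega
  have hv3 : 3 ≤ padicValNat 2 (p ^ 2 - 1) := (padicValNat_dvd_iff_le hne).mp (by simpa using h8)
  by_cases hc : p % 8 = 3 ∨ p % 8 = 5
  · rw [if_pos hc]
    have hn16 : ¬ 16 ∣ p ^ 2 - 1 := fun h => by rcases h16.mp h with h' | h' <;> omega
    have hv4 : ¬ 4 ≤ padicValNat 2 (p ^ 2 - 1) := fun h => hn16 (by simpa using (padicValNat_dvd_iff_le hne).mpr h)
    have hv : padicValNat 2 (p ^ 2 - 1) - 3 = 0 := by omega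
    rw [hv, pow_zero]
    rfl
  · rw [if_neg hc]
    have hc' : p % 8 = 1 ∨ p % 8 = 7 := by omega
    have hv4 : 4 ≤ padicValNat 2 (p ^ 2 - 1) := (padicValNat_dvd_iff_le hne).mp (by simpa using h16.mpr hc')
    obtain ⟨k, hk⟩ : ∃ k, padicValNat 2 (p ^ 2 - 1) - 3 = k + 1 := ⟨padicValNat 2 (p ^ 2 - 1) - 4, by omega⟩
    rw [hk, pow_succ, Nat.mul_mod_left]

/-- **The Ferrero–Kida sum has the parity of `#{p ∣ d odd prime : p ≡ ±3 (mod 8)}`.** [cite: Schettler2014, Thm. 2] -/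
theorem ferreroKidaSum_mod_two (d : ℕ) :
    (∑ p ∈ d.primeFactors.erase 2, 2 ^ (padicValNat 2 (p ^ 2 - 1) - 3)) % 2 =
      ((d.primeFactors.erase 2).filter (fun p => p % 8 = 3 ∨ p % 8 = 5)).card % 2 := by
  rw [Finset.sum_nat_mod, Finset.card_filter]
  congr 1
  refine Finset.sum_congr rfl fun p hp => ?_
  have hp' := Finset.mem_erase.mp hp
  have hprime : p.Prime := Nat.prime_of_mem_primeFactors hp'.2
  exact two_pow_padicValNat_sq_sub_one_mod_two hprime hp'.1

/-- For odd `d`, no prime factor is `2`: `(primeFactors d).erase 2 = primeFactors d`. [folklore] -/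
private theorem primeFactors_erase_two_of_odd {d : ℕ} (hd : Odd d) : d.primeFactors.erase 2 = d.primeFactors := by
  refine Finset.erase_eq_of_notMem fun h => ?_
  have h2 : 2 ∣ d := Nat.dvd_of_mem_primeFactors h
  exact (Nat.not_even_iff_odd.mpr hd) (even_iff_two_dvd.mpr h2)

/-- ★ **For odd squarefree `d`: `#{p ∣ d : p ≡ ±3 (mod 8)}` is EVEN iff `d ≡ ±1 (mod 8)`** — the quadratic character `χ₈ = (2/·)` (Mathlib `ZMod.χ₈`: `+1` on
`±1`, `−1` on `±3 (mod 8)`) is multiplicative and `d = ∏_{p ∣ d} p`, so `χ₈(d) = (−1)^{#{p ∣ d : p ≡ ±3 (8)}}`. [cite: Washington1997, Thm. 10.8 (`f` = 2 iff `p ≡ ±3 (mod 8)`)] -/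
theorem even_card_filter_iff_mod_eight {d : ℕ} (hd : Squarefree d) (hodd : Odd d) :
    Even ((d.primeFactors.filter (fun p => p % 8 = 3 ∨ p % 8 = 5)).card) ↔ (d % 8 = 1 ∨ d % 8 = 7) := by
  -- `χ₈ d = ∏ χ₈ p = (−1)^{#S}`
  have hprod : (d : ZMod 8) = ∏ p ∈ d.primeFactors, ((p : ℕ) : ZMod 8) := by
    rw [← Nat.cast_prod, Nat.prod_primeFactors_of_squarefree hd]
  have hχd : ZMod.χ₈ (d : ZMod 8) = ∏ p ∈ d.primeFactors, ZMod.χ₈ ((p : ℕ) : ZMod 8) := by rw [hprod, map_prod]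
  have hχp : ∀ p ∈ d.primeFactors, ZMod.χ₈ ((p : ℕ) : ZMod 8) = if p % 8 = 3 ∨ p % 8 = 5 then -1 else 1 := by
    intro p hp
    have hprime : p.Prime := Nat.prime_of_mem_primeFactors hp
    have hp2 : p ≠ 2 := fun h => by
      rw [h] at hp
      exact (Nat.not_even_iff_odd.mpr hodd) (even_iff_two_dvd.mpr (Nat.dvd_of_mem_primeFactors hp))
    have hpo : p % 2 = 1 := Nat.odd_iff.mp (hprime.odd_of_ne_two hp2)
    rw [ZMod.χ₈_nat_eq_if_mod_eight, if_neg (by omega)]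
    by_cases h : p % 8 = 3 ∨ p % 8 = 5
    · rw [if_pos h, if_neg (by omega)]
    · rw [if_neg h, if_pos (by omega)]
  rw [Finset.prod_congr rfl hχp, ← Finset.prod_filter, Finset.prod_const] at hχd
  -- `χ₈ d = ±1` according to `d mod 8`
  have hdo : d % 2 = 1 := Nat.odd_iff.mp hodd
  rw [ZMod.χ₈_nat_eq_if_mod_eight, if_neg (by omega)] at hχd
  have hm1 : (-1 : ℤ) ≠ 1 := by decide
  constructor
  · intro he
    by_contra hne
    rw [if_neg hne, he.neg_one_pow] at hχd
    exact hm1 hχd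
  · intro h
    rw [if_pos h] at hχd
    exact (neg_one_pow_eq_one_iff_even hm1).mp hχd.symm

/-- **The Ferrero–Kida sum is EVEN iff `d ≡ ±1 (mod 8)`** (`d` odd squarefree); equivalently `λ₂(ℚ(√−d)) = Σ − 1` is ODD iff `d ≡ ±1 (mod 8)`.
[cite: Schettler2014, Thm. 2] -/
theorem ferreroKidaSum_mod_two_eq_zero_iff {d : ℕ} (hd : Squarefree d) (hodd : Odd d) :
    (∑ p ∈ d.primeFactors.erase 2, 2 ^ (padicValNat 2 (p ^ 2 - 1) - 3)) % 2 = 0 ↔ (d % 8 = 1 ∨ d % 8 = 7) := by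
  rw [ferreroKidaSum_mod_two, primeFactors_erase_two_of_odd hodd, ← Nat.even_iff, even_card_filter_iff_mod_eight hd hodd]


end Literature.NumberTheory.IwasawaTheory

end
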